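import Literature.MathematicalPhysics.QuantumLattice.InfiniteVolumeLSMProofs
import HarnessLib

/-!
# No unique gapped ground state for half-odd-integer spin chains (`HasUniqueGappedGroundState` form)

Trunk **T-QLATTICE**, family `hubbard`, statement **hubbard.S23**. Proof file (one theorem) of
`Literature/MathematicalPhysics/QuantumLattice/InfiniteVolume.lean`: it discharges the named fact
`not_hasUniqueGappedGroundState_halfOddSpin` — for the spin-`S` Heisenberg chain
`H = J Σ_x 𝐒_x·𝐒_{x+1}` with `S = n/2` half-odd-integer (`n` odd) and any coupling `J`,
`¬ HasUniqueGappedGroundState (heisenbergInteraction n J) 1` — as the corollary, in the prelude's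
vocabulary (`HasUniqueGappedGroundState Φ R = HasUniqueGroundState Φ R ∧ ∃ ω γ, ω.IsGappedGroundState Φ R γ`),
of the Affleck–Lieb theorem `no_unique_gapped_groundState_halfOddSpin` discharged in
`InfiniteVolumeLSMProofs.lean` (`no_unique_gapped_groundState_halfOddSpin_holds`: if the ground
state is unique, no ground state is gapped). This is the two-line interim proof recorded in
`InfiniteVolume.lean`. An independent route to the same theorem through Koma's inequality
(Tasaki 2018, Lemma 2) and bounded block-charge fluctuations is provided by the helper files
`InfiniteVolumeLSM{State,Bond,Chain,Koma}Proofs.lean`.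

## References

* I. Affleck, E. H. Lieb, *A proof of part of Haldane's conjecture on spin chains*,
  Lett. Math. Phys. 12 (1986) 57–69, Thm. 2 (not held; doi:10.1007/BF00400304). [AffleckLiebLMP1986]
* H. Tasaki, *The Lieb–Schultz–Mattis theorem: a topological point of view*, EMS Press (2022),
  arXiv:2202.06243 (held), §2.1 Def. 2.5, §3.2 Cor. 3.6 (Affleck–Lieb theorem). [Tasaki2022]
* Y. Ogata, H. Tasaki, Comm. Math. Phys. 372 (2019) 951–962, arXiv:1808.08740 (held), §2 Def. 2.1,
  Thm. 2.3. [OgataTasaki2019]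
* H. Tasaki, *Physics and Mathematics of Quantum Many-Body Systems* (Springer 2020), App. A.7
  Def. A.16, Thm. 8.5 — the cite carried by the fact (not held). [Tasaki2020]
-/

noncomputable section

namespace Literature.MathematicalPhysics.QuantumLattice

/-- **Discharge of `not_hasUniqueGappedGroundState_halfOddSpin` (hubbard.S23).** A
half-odd-integer-spin Heisenberg chain (`n` odd, any `J`) has no unique gapped ground state in
infinite volume: if `HasUniqueGroundState` holds and some ground state `ω` were gapped with gap `γ`,
`no_unique_gapped_groundState_halfOddSpin_holds n hn J ω γ` (the Affleck–Lieb theorem,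
`InfiniteVolumeLSMProofs.lean`) refutes it. Affleck–Lieb (1986) Thm. 2; Ogata–Tasaki (2019)
Thm. 2.3; Tasaki (2022) Cor. 3.6; Tasaki (2020) Thm. 8.5. [cite: Tasaki2022, §3.2 Cor. 3.6] -/
theorem not_hasUniqueGappedGroundState_halfOddSpin_holds :
    not_hasUniqueGappedGroundState_halfOddSpin := by
  rintro n hn J ⟨huniq, ω, γ, hgap⟩
  exact no_unique_gapped_groundState_halfOddSpin_holds n hn J ω γ huniq hgap.isGroundState hgap

end Literature.MathematicalPhysics.QuantumLattice
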